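import Literature.NumberTheory.Transcendental.GaGmBezout
import HarnessLib

/-!
# Philippon's zero estimate on `𝔾ₐ × 𝔾ₘ^n`: Hilbert-function bookkeeping for non-zero-divisors

Topic `Literature/NumberTheory/Transcendental`. Seventh module of the inline discharge of
`Literature.NumberTheory.Transcendental.Philippon1986_GaGm`. It extends the Hilbert-function
toolkit of `GaGmBezout.lean` (box filtration `Box(t)`, `H_N(t) = GaGm.hilbI D₀ D₁ N t`) from
primes to **non-zero-divisors modulo an arbitrary ideal**, which is what the multiplicity version
of Roy's Prop. 2.2 / Thm. 4.1 (LNM 1752, Ch. 11) needs, and proves a **Bézout-type upper bound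
with a lossy constant** for chains of ideals cut out by successive non-zero-divisors of box degree
`1` — sufficient for Philippon's theorem, whose constant `c` only has to depend on `n`. PROVED:

* `IsNZDMod J Q` (`Q f ∈ J ⇒ f ∈ J`); `map_mulLeft_inf_of_nzd`, `finrank_mulShift_of_nzd`;
* `hilbI_sup_span_add_le_of_nzd` — the section inequality `H_{J+(Q)}(t) + H_J(t-1) ≤ H_J(t)`
  for `Q ∈ Box(1)` a non-zero-divisor modulo `J`;
* `hilbI_add_le_hilbI_inf_of_nzd` — additivity `H_N(t) + H_J(t-δ) ≤ H_{N ∩ J}(t)` for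
  `a ∈ N ∩ Box(δ)` a non-zero-divisor modulo `J`;
* `hilbI_le_of_sum_le` — the doubling trick `(t+1) H'(t) ≤ ∑_{s ≤ 2t+1} H'(s)` (monotonicity);
* **`hilbI_chain_le`** — if `𝔍₀ ≤ 𝔍₁ ≤ ⋯` with `𝔍_{j} + (Q_{j+1}) ≤ 𝔍_{j+1}` and `Q_{j+1} ∈ Box(1)`
  a non-zero-divisor modulo `𝔍_j`, then `H_{𝔍_j}(t) ≤ 2^{(n+1)j} D₀ D₁ⁿ (t+1)^{n+1-j}` (`j ≤ n+1`).

## References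

* Yu. V. Nesterenko, P. Philippon (eds.), *Introduction to Algebraic Independence Theory*,
  LNM 1752, Springer 2001, Ch. 11 (D. Roy), §2.2 (iii) (Bézout's Lemma), Prop. 2.2.
* P. Philippon, *Lemmes de zéros dans les groupes algébriques commutatifs*, Bull. Soc. Math.
  France 114 (1986), 355–383, Prop. 3.3.
-/

noncomputable section

open MvPolynomial Module

namespace Literature.NumberTheory.Transcendental

namespace GaGm

variable {n : ℕ} {D₀ D₁ : ℕ}

/-- `Q` is a non-zero-divisor modulo the ideal `J`: `Q f ∈ J ⇒ f ∈ J`. [folklore] -/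
def IsNZDMod (J : Ideal (MvPolynomial (Fin (n + 1)) ℂ)) (Q : MvPolynomial (Fin (n + 1)) ℂ) : Prop :=
  ∀ f : MvPolynomial (Fin (n + 1)) ℂ, Q * f ∈ J → f ∈ J

/-- A non-zero-divisor modulo a proper ideal is non-zero. [folklore] -/
theorem IsNZDMod.ne_zero {J : Ideal (MvPolynomial (Fin (n + 1)) ℂ)} {Q : MvPolynomial (Fin (n + 1)) ℂ}
    (h : IsNZDMod J Q) (hJ : J ≠ ⊤) : Q ≠ 0 := by
  rintro rfl
  exact hJ ((Ideal.eq_top_iff_one _).mpr (h 1 (by simp)))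

/-- Outside a prime one is a non-zero-divisor modulo it. [folklore] -/
theorem isNZDMod_of_isPrime {𝔭 : Ideal (MvPolynomial (Fin (n + 1)) ℂ)} (h𝔭 : 𝔭.IsPrime)
    {Q : MvPolynomial (Fin (n + 1)) ℂ} (hQ : Q ∉ 𝔭) : IsNZDMod 𝔭 Q :=
  fun _ h => (h𝔭.mem_or_mem h).resolve_left hQ

/-- `(a·M) ∩ J = a·(M ∩ J)` for `a` a non-zero-divisor modulo `J`. [folklore] -/
theorem map_mulLeft_inf_of_nzd {J : Ideal (MvPolynomial (Fin (n + 1)) ℂ)} {a : MvPolynomial (Fin (n + 1)) ℂ}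
    (ha : IsNZDMod J a) (M : Submodule ℂ (MvPolynomial (Fin (n + 1)) ℂ)) :
    M.map (LinearMap.mulLeft ℂ a) ⊓ J.restrictScalars ℂ = (M ⊓ J.restrictScalars ℂ).map (LinearMap.mulLeft ℂ a) := by
  ext x
  simp only [Submodule.mem_inf, Submodule.mem_map, LinearMap.mulLeft_apply, Submodule.restrictScalars_mem]
  constructor
  · rintro ⟨⟨v, hv, rfl⟩, hx⟩
    exact ⟨v, ⟨hv, ha v hx⟩, rfl⟩
  · rintro ⟨v, ⟨hv, hvJ⟩, rfl⟩
    exact ⟨⟨v, hv, rfl⟩, J.mul_mem_left a hvJ⟩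

/-- The dimension identity `dim(a·Box(t-δ) + Box(t) ∩ J) + dim(Box(t-δ) ∩ J) =
dim Box(t-δ) + dim(Box(t) ∩ J)` for `a ∈ Box(δ)` a non-zero-divisor modulo `J ≠ (1)`. [folklore] -/
theorem finrank_mulShift_of_nzd {J : Ideal (MvPolynomial (Fin (n + 1)) ℂ)} (hJ : J ≠ ⊤)
    {a : MvPolynomial (Fin (n + 1)) ℂ} {δ : ℕ} (haB : a ∈ Box (n := n) D₀ D₁ δ) (ha : IsNZDMod J a)
    {t : ℕ} (ht : δ ≤ t) :
    finrank ℂ ↥((Box (n := n) D₀ D₁ (t - δ)).map (LinearMap.mulLeft ℂ a) ⊔ (Box D₀ D₁ t ⊓ J.restrictScalars ℂ)) +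
      finrank ℂ ↥(Box (n := n) D₀ D₁ (t - δ) ⊓ J.restrictScalars ℂ) =
    finrank ℂ ↥(Box (n := n) D₀ D₁ (t - δ)) + finrank ℂ ↥(Box (n := n) D₀ D₁ t ⊓ J.restrictScalars ℂ) := by
  have ha0 : a ≠ 0 := ha.ne_zero hJ
  have h1 := Submodule.finrank_sup_add_finrank_inf_eq
    ((Box (n := n) D₀ D₁ (t - δ)).map (LinearMap.mulLeft ℂ a)) (Box D₀ D₁ t ⊓ J.restrictScalars ℂ)
  have hle : (Box (n := n) D₀ D₁ (t - δ)).map (LinearMap.mulLeft ℂ a) ≤ Box D₀ D₁ t := by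
    have := map_mulLeft_Box_le (n := n) (s := t - δ) haB
    rwa [Nat.sub_add_cancel ht] at this
  have hinf : (Box (n := n) D₀ D₁ (t - δ)).map (LinearMap.mulLeft ℂ a) ⊓ (Box D₀ D₁ t ⊓ J.restrictScalars ℂ) =
      (Box (n := n) D₀ D₁ (t - δ) ⊓ J.restrictScalars ℂ).map (LinearMap.mulLeft ℂ a) := by
    rw [← inf_assoc, inf_eq_left.mpr hle, map_mulLeft_inf_of_nzd ha]
  rw [hinf, finrank_map_mulLeft ha0, finrank_map_mulLeft ha0] at h1
  omega

/-- **The section inequality for a non-zero-divisor**: `Q ∈ Box(1)` a non-zero-divisor modulo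
`J ≠ (1)`, `t ≥ 1` ⇒ `H_{J+(Q)}(t) + H_J(t-1) ≤ H_J(t)` (LNM 1752, Ch. 11, §2.2 (iii), read for the
box filtration). [cite: NesterenkoPhilippon2001, Ch. 11 §2.2 (iii)] -/
theorem hilbI_sup_span_add_le_of_nzd {J : Ideal (MvPolynomial (Fin (n + 1)) ℂ)} (hJ : J ≠ ⊤)
    {Q : MvPolynomial (Fin (n + 1)) ℂ} (hQB : Q ∈ Box (n := n) D₀ D₁ 1) (hQ : IsNZDMod J Q) {t : ℕ} (ht : 1 ≤ t) :
    hilbI (n := n) D₀ D₁ ((J ⊔ Ideal.span {Q}).restrictScalars ℂ) t + hilbI D₀ D₁ (J.restrictScalars ℂ) (t - 1) ≤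
      hilbI D₀ D₁ (J.restrictScalars ℂ) t := by
  have key := finrank_mulShift_of_nzd (D₀ := D₀) (D₁ := D₁) hJ hQB hQ ht
  have hle : (Box (n := n) D₀ D₁ (t - 1)).map (LinearMap.mulLeft ℂ Q) ⊔ (Box D₀ D₁ t ⊓ J.restrictScalars ℂ) ≤
      Box D₀ D₁ t ⊓ (J ⊔ Ideal.span {Q}).restrictScalars ℂ := by
    refine sup_le ?_ (inf_le_inf_left _ fun x hx => Ideal.mem_sup_left hx)
    have h1 : (Box (n := n) D₀ D₁ (t - 1)).map (LinearMap.mulLeft ℂ Q) ≤ Box D₀ D₁ t := by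
      have := map_mulLeft_Box_le (n := n) (s := t - 1) hQB
      rwa [Nat.sub_add_cancel ht] at this
    refine le_inf h1 ?_
    rintro _ ⟨v, -, rfl⟩
    exact Ideal.mem_sup_right (Ideal.mem_span_singleton.mpr (dvd_mul_right Q v))
  have h2 := Submodule.finrank_mono hle
  have h3 := hilbI_add_finrank_inf (n := n) (D₀ := D₀) (D₁ := D₁) ((J ⊔ Ideal.span {Q}).restrictScalars ℂ) t
  have h4 := hilbI_add_finrank_inf (n := n) (D₀ := D₀) (D₁ := D₁) (J.restrictScalars ℂ) t
  have h5 := hilbI_add_finrank_inf (n := n) (D₀ := D₀) (D₁ := D₁) (J.restrictScalars ℂ) (t - 1)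
  omega

/-- **Additivity for a non-zero-divisor**: for a subspace `N` closed under multiplication, an ideal
`J ≠ (1)` and `a ∈ N ∩ Box(δ)` a non-zero-divisor modulo `J`, `t ≥ δ`:
`H_N(t) + H_J(t-δ) ≤ H_{N ∩ J}(t)`. [folklore] -/
theorem hilbI_add_le_hilbI_inf_of_nzd {N : Submodule ℂ (MvPolynomial (Fin (n + 1)) ℂ)}
    {J : Ideal (MvPolynomial (Fin (n + 1)) ℂ)} (hJ : J ≠ ⊤)
    {a : MvPolynomial (Fin (n + 1)) ℂ} {δ : ℕ} (haB : a ∈ Box (n := n) D₀ D₁ δ) (haN : a ∈ N)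
    (hN : ∀ (x y : MvPolynomial (Fin (n + 1)) ℂ), y ∈ N → x * y ∈ N) (ha : IsNZDMod J a) {t : ℕ} (ht : δ ≤ t) :
    hilbI (n := n) D₀ D₁ N t + hilbI D₀ D₁ (J.restrictScalars ℂ) (t - δ) ≤
      hilbI D₀ D₁ (N ⊓ J.restrictScalars ℂ) t := by
  have key := finrank_mulShift_of_nzd (D₀ := D₀) (D₁ := D₁) hJ haB ha ht
  have h1 := Submodule.finrank_sup_add_finrank_inf_eq (Box (n := n) D₀ D₁ t ⊓ N) (Box D₀ D₁ t ⊓ J.restrictScalars ℂ)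
  have hinf : Box (n := n) D₀ D₁ t ⊓ N ⊓ (Box D₀ D₁ t ⊓ J.restrictScalars ℂ) =
      Box D₀ D₁ t ⊓ (N ⊓ J.restrictScalars ℂ) := by
    rw [inf_inf_inf_comm, inf_idem]
  rw [hinf] at h1
  have hle : (Box (n := n) D₀ D₁ (t - δ)).map (LinearMap.mulLeft ℂ a) ⊔ (Box D₀ D₁ t ⊓ J.restrictScalars ℂ) ≤
      (Box D₀ D₁ t ⊓ N) ⊔ (Box D₀ D₁ t ⊓ J.restrictScalars ℂ) := by
    refine sup_le_sup_right ?_ _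
    have h1 : (Box (n := n) D₀ D₁ (t - δ)).map (LinearMap.mulLeft ℂ a) ≤ Box D₀ D₁ t := by
      have := map_mulLeft_Box_le (n := n) (s := t - δ) haB
      rwa [Nat.sub_add_cancel ht] at this
    refine le_inf h1 ?_
    rintro _ ⟨v, -, rfl⟩
    rw [LinearMap.mulLeft_apply, mul_comm]
    exact hN v a haN
  have h2 := Submodule.finrank_mono hle
  have h3 := hilbI_add_finrank_inf (n := n) (D₀ := D₀) (D₁ := D₁) N t
  have h4 := hilbI_add_finrank_inf (n := n) (D₀ := D₀) (D₁ := D₁) (J.restrictScalars ℂ) (t - δ)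
  have h5 := hilbI_add_finrank_inf (n := n) (D₀ := D₀) (D₁ := D₁) (N ⊓ J.restrictScalars ℂ) t
  have h6 := finrank_inf_le (n := n) (D₀ := D₀) (D₁ := D₁) (J.restrictScalars ℂ) t
  omega

/-! ### The lossy Bézout bound along a chain of non-zero-divisors -/

/-- **Doubling trick**: a monotone `ℕ`-valued function satisfies
`(t+1)·f(t) ≤ ∑_{s ≤ 2t+1} f(s)`. [folklore] -/
theorem mul_le_sum_of_monotone {f : ℕ → ℕ} (hf : Monotone f) (t : ℕ) :
    (t + 1) * f t ≤ ∑ s ∈ Finset.range (2 * t + 2), f s := by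
  have h1 : ∑ s ∈ Finset.Ico (t + 1) (2 * t + 2), f t ≤ ∑ s ∈ Finset.Ico (t + 1) (2 * t + 2), f s :=
    Finset.sum_le_sum fun s hs => hf (by rw [Finset.mem_Ico] at hs; omega)
  rw [Finset.sum_const, Nat.card_Ico, smul_eq_mul, show 2 * t + 2 - (t + 1) = t + 1 by omega] at h1
  refine h1.trans ?_
  rw [Finset.range_eq_Ico]
  exact Finset.sum_le_sum_of_subset_of_nonneg (Finset.Ico_subset_Ico (Nat.zero_le _) le_rfl)
    fun _ _ _ => Nat.zero_le _

/-- One step of the lossy Bézout bound: if `Q ∈ Box(1)` is a non-zero-divisor modulo `J ≠ (1)` and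
`J + (Q) ≤ J'`, then `(t+1)·H_{J'}(t) ≤ H_J(2t+1)`. [folklore] -/
theorem succ_mul_hilbI_le {J J' : Ideal (MvPolynomial (Fin (n + 1)) ℂ)} (hJ : J ≠ ⊤)
    {Q : MvPolynomial (Fin (n + 1)) ℂ} (hQB : Q ∈ Box (n := n) D₀ D₁ 1) (hQ : IsNZDMod J Q)
    (hJ' : J ⊔ Ideal.span {Q} ≤ J') (t : ℕ) :
    (t + 1) * hilbI (n := n) D₀ D₁ (J'.restrictScalars ℂ) t ≤ hilbI D₀ D₁ (J.restrictScalars ℂ) (2 * t + 1) := by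
  have hmono : Monotone fun s => hilbI (n := n) D₀ D₁ (J'.restrictScalars ℂ) s :=
    fun s s' h => hilbI_mono _ h
  refine (mul_le_sum_of_monotone hmono t).trans ?_
  have hsum := sum_hilbI_le (n := n) (D₀ := D₀) (D₁ := D₁)
    (J := (J ⊔ Ideal.span {Q}).restrictScalars ℂ) (P := J.restrictScalars ℂ)
    (fun x hx => Ideal.mem_sup_left hx) (fun s hs => hilbI_sup_span_add_le_of_nzd hJ hQB hQ hs) (2 * t + 1)
  refine le_trans (Finset.sum_le_sum fun s _ => ?_) hsum
  exact hilbI_antitone (n := n) (D₀ := D₀) (D₁ := D₁) (fun x hx => hJ' hx) s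

/-- `H_{(0)}(t) = dim Box(t) = (tD₀+1)(tD₁+1)ⁿ ≤ D₀ D₁ⁿ (t+1)^{n+1}` for `D₀, D₁ ≥ 1`. [folklore] -/
theorem hilbI_bot_le (hD₀ : 1 ≤ D₀) (hD₁ : 1 ≤ D₁) (t : ℕ) :
    hilbI (n := n) D₀ D₁ ((⊥ : Ideal (MvPolynomial (Fin (n + 1)) ℂ)).restrictScalars ℂ) t ≤
      D₀ * D₁ ^ n * (t + 1) ^ (n + 1) := by
  have h : hilbI (n := n) D₀ D₁ ((⊥ : Ideal (MvPolynomial (Fin (n + 1)) ℂ)).restrictScalars ℂ) t =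
      (t * D₀ + 1) * (t * D₁ + 1) ^ n := by
    rw [← hilb_univ (n := n) (D₀ := D₀) (D₁ := D₁) t, hilb, vanishing_univ]
  rw [h, pow_succ]
  have h1 : t * D₀ + 1 ≤ D₀ * (t + 1) := by nlinarith
  have h2 : (t * D₁ + 1) ^ n ≤ (D₁ * (t + 1)) ^ n := Nat.pow_le_pow_left (by nlinarith) n
  calc (t * D₀ + 1) * (t * D₁ + 1) ^ n ≤ (D₀ * (t + 1)) * (D₁ * (t + 1)) ^ n :=
        Nat.mul_le_mul h1 h2
    _ = D₀ * D₁ ^ n * ((t + 1) ^ n * (t + 1)) := by rw [mul_pow]; ring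

/-- **The lossy Bézout bound along a chain.** Let `𝔍 : ℕ → Ideal` be a chain starting at `(0)`
with `𝔍 j + (Q (j+1)) ≤ 𝔍 (j+1)`, `Q (j+1) ∈ Box(1)` a non-zero-divisor modulo `𝔍 j ≠ (1)` for
`j < r`. Then for `j ≤ r`, `j ≤ n + 1`:
`H_{𝔍 j}(t) ≤ 2^{(n+1) j} · D₀ D₁ⁿ · (t+1)^{n+1-j}` — each proper cut by a box-degree-one
non-zero-divisor lowers the growth order by one, at the price of a factor `2^{n+1}` in the constant
(Roy's Prop. 2.2 has the sharp constant; for Philippon's theorem any constant depending on `n`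
suffices). [cite: NesterenkoPhilippon2001, Ch. 11 Prop. 2.2 (lossy form)] -/
theorem hilbI_chain_le (hD₀ : 1 ≤ D₀) (hD₁ : 1 ≤ D₁) (𝔍 : ℕ → Ideal (MvPolynomial (Fin (n + 1)) ℂ))
    (Q : ℕ → MvPolynomial (Fin (n + 1)) ℂ) (r : ℕ) (h0 : 𝔍 0 = ⊥)
    (hne : ∀ j < r, 𝔍 j ≠ ⊤) (hQB : ∀ j < r, Q (j + 1) ∈ Box (n := n) D₀ D₁ 1)
    (hQ : ∀ j < r, IsNZDMod (𝔍 j) (Q (j + 1))) (hstep : ∀ j < r, 𝔍 j ⊔ Ideal.span {Q (j + 1)} ≤ 𝔍 (j + 1)) :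
    ∀ j, j ≤ r → j ≤ n + 1 → ∀ t,
      hilbI (n := n) D₀ D₁ ((𝔍 j).restrictScalars ℂ) t ≤ 2 ^ ((n + 1) * j) * (D₀ * D₁ ^ n) * (t + 1) ^ (n + 1 - j) := by
  intro j
  induction j with
  | zero =>
    intro _ _ t
    rw [h0]
    simpa [mul_assoc] using hilbI_bot_le (n := n) hD₀ hD₁ t
  | succ j ih =>
    intro hjr hjn t
    have hj : j < r := by omega
    have hstep' := succ_mul_hilbI_le (D₀ := D₀) (D₁ := D₁) (hne j hj) (hQB j hj) (hQ j hj) (hstep j hj) t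
    have hih := ih (by omega) (by omega) (2 * t + 1)
    -- `(t+1) H_{j+1}(t) ≤ H_j(2t+1) ≤ 2^{(n+1)j} D₀D₁ⁿ (2t+2)^{n+1-j}`
    have e1 : (2 * t + 1 + 1) ^ (n + 1 - j) = 2 ^ (n + 1 - j) * (t + 1) ^ (n - j) * (t + 1) := by
      rw [show 2 * t + 1 + 1 = 2 * (t + 1) by ring, mul_pow, show n + 1 - j = (n - j) + 1 by omega,
        pow_succ]
      ring
    rw [e1] at hih
    have h3 : (t + 1) * hilbI (n := n) D₀ D₁ ((𝔍 (j + 1)).restrictScalars ℂ) t ≤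
        (t + 1) * (2 ^ ((n + 1) * (j + 1)) * (D₀ * D₁ ^ n) * (t + 1) ^ (n + 1 - (j + 1))) := by
      refine (hstep'.trans hih).trans ?_
      rw [show n + 1 - (j + 1) = n - j by omega]
      have h2pow : 2 ^ ((n + 1) * j) * 2 ^ (n + 1 - j) ≤ 2 ^ ((n + 1) * (j + 1)) := by
        rw [← pow_add]
        exact Nat.pow_le_pow_right (by norm_num) (by rw [Nat.mul_succ]; omega)
      calc 2 ^ ((n + 1) * j) * (D₀ * D₁ ^ n) * (2 ^ (n + 1 - j) * (t + 1) ^ (n - j) * (t + 1))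
          = (t + 1) * ((2 ^ ((n + 1) * j) * 2 ^ (n + 1 - j)) * (D₀ * D₁ ^ n) * (t + 1) ^ (n - j)) := by ring
        _ ≤ (t + 1) * (2 ^ ((n + 1) * (j + 1)) * (D₀ * D₁ ^ n) * (t + 1) ^ (n - j)) :=
          Nat.mul_le_mul_left _ (Nat.mul_le_mul_right _ (Nat.mul_le_mul_right _ h2pow))
    exact Nat.le_of_mul_le_mul_left h3 (Nat.succ_pos t)

end GaGm

end Literature.NumberTheory.Transcendental
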